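import Literature.AlgebraicTopology.SingularHomology.HomologySelfMapFixingOpenSetTrace
import Mathlib.Algebra.Polynomial.AlgebraMap
import Mathlib.Algebra.Algebra.Equiv
import HarnessLib

/-!
# Polynomial relations of a self-map which is the identity on an open set DESCEND to the invariant piece
# (`P(h_* − 1) = 0` on `Hₙ(X)` ⟹ `(h_A* − 1)·P(h_A* − 1) = 0` on `Hₙ(A)`; unipotent globally ⟹ unipotent locally)

Layer `Literature/AlgebraicTopology/SingularHomology`; theorems only (no definition, no named fact). Written by the
prover seat `hodge-nonav-prover-Bx` (g16, cell `hodge-nonav`) as brick B3⁺ of the programme «A₃-TRACE» (binder hN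
`stub_a3NonComm` of crux K1-B `VeryGeneralSignCommutatorsInHg`, `Summits/HodgeConjecture/HodgeConjecture/Theses/SignSymmetricPowers.lean`,
stmt-HodgeConjecture-19716). Companion of `HomologySelfMapFixingOpenSetTrace` (the trace localises) and CONVERSE direction
of prover-Ax's `HomologySelfMapFixingOpenSet.sum_smul_pow_map_sub_self_eq_zero_of_eqOn` (local relations kill the global
variation): here GLOBAL relations descend to the LOCAL action, at the price of one extra factor `x`.

**Setting.** `X = A ∪ B` an open cover, `h : X → X` continuous with `h = id` on `B` and `h(A) ⊆ A`, restriction `h_A`.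
Write `N = h_* − 1` on `Hₙ(X)` and `N' = (h_A)_* − 1` on `Hₙ(A)`; then `N ι = ι N'` (naturality) and `N'` vanishes on
`ker ι` (`map_sub_self_eq_zero_of_mem_ker_of_eqOn`: excision + naturality of `∂`).

**Results.**
* §1 (linear algebra, any commutative ring) `LinearMap.apply_aeval_eq_of_comp_eq` (`ι ∘ P(N') = P(N) ∘ ι`),
  `LinearMap.aeval_X_mul_eq_zero_of_comp_eq_of_ker_le` (`P(N) = 0 ⟹ (X·P)(N') = 0`),
  `LinearMap.isNilpotent_of_comp_eq_of_ker_le` (`N` nilpotent ⟹ `N'` nilpotent).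
* §2 (homology) `singularHomology.aeval_X_mul_map_sub_id_eq_zero_of_eqOn`, `singularHomology.isNilpotent_map_sub_id_of_eqOn`
  — **if `h_*` is unipotent on `Hₙ(X)` then `(h_A)_*` is unipotent on `Hₙ(A)`**; and the transfer to a model
  `μ : F₀ → F₀` through a chart `e : A → F₀` bijective on `Hₙ` with `e ∘ h_A ≃ μ ∘ e`
  (`singularHomology.aeval_map_sub_id_eq_zero_iff_of_homologyConj`).
* §3 (cohomology, field coefficients, `Hₙ(X)` finite-dimensional) `singularCohomology.aeval_homologyMap_sub_id_eq_zero_of_aeval_eq_zero`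
  — a polynomial relation of an automorphism `T` of `Hⁿ(X; F)` acting as `h^*` is a relation of `h_*` on `Hₙ(X; F)`
  (Kronecker duality), and the end-to-end form `singularCohomology.aeval_X_mul_modelMap_sub_id_eq_zero_of_eqOn`:
  **`P(T − 1) = 0` on `Hⁿ(X; F)` ⟹ `(μ_* − 1)·P(μ_* − 1) = 0` on `Hₙ(F₀; F)`**.

Use (programme A₃-TRACE, unipotency variant): if the two transports of the symmetric `A₃` unfolding commuted, their
product — conjugate to the transport `h` around the `A₃` point — would be unipotent (odd fibre dimension) or an involution
(even); descending to the Milnor fibre this forces the weighted rotation `g` of the Pham–Brieskorn fibre `(4, 2, …, 2)`,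
which has `g⁴ = 1`, to satisfy `g_* = 1` resp. `g_*² = 1` on `Hₙ(F₀)` — contradicting the character `ζ₄ ↦ ζ₄` of the
quartic coordinate (Milnor–Pham).

## References

* [HatcherAT2002] A. Hatcher, Algebraic Topology, CUP 2002, §2.1 Thm. 2.13 ff., Thm. 2.20; §3.1 p. 201.
* [ArnoldGuseinzadeVarchenko2012] V. I. Arnold, S. M. Gusein-Zade, A. N. Varchenko, Singularities of Differentiable Maps,
  Vol. 2, Part I §1.1 (variation operator; held text p0013, p0025), §2.3.
-/

noncomputable section

open CategoryTheory Limits Set Polynomial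

universe u v

/-! ### §1 Linear algebra: relations of `N` descend to `N'` when `N ι = ι N'` and `N'` kills `ker ι` -/

namespace LinearMap

variable {K : Type*} [CommRing K] {V W : Type*} [AddCommGroup V] [Module K V] [AddCommGroup W] [Module K W]

/-- `ι (P(N') w) = P(N) (ι w)` for semiconjugate endomorphisms `N ι = ι N'`. [cite: HatcherAT2002, §2.1 (naturality)] -/
theorem apply_aeval_eq_of_comp_eq (ι : W →ₗ[K] V) (N : Module.End K V) (N' : Module.End K W)
    (hcomm : N ∘ₗ ι = ι ∘ₗ N') (P : K[X]) (w : W) : ι (aeval N' P w) = aeval N P (ι w) := by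
  induction P using Polynomial.induction_on generalizing w with
  | C r =>
    rw [aeval_C, aeval_C, Module.algebraMap_end_apply, Module.algebraMap_end_apply, map_smul]
  | add p q hp hq =>
    rw [aeval_add, aeval_add, LinearMap.add_apply, LinearMap.add_apply, map_add, hp, hq]
  | monomial i r hi =>
    rw [pow_succ, ← mul_assoc]
    conv_lhs => rw [aeval_mul, aeval_X, Module.End.mul_apply]
    conv_rhs => rw [aeval_mul, aeval_X, Module.End.mul_apply]
    rw [hi (N' w)]
    congr 1
    rw [← LinearMap.comp_apply N ι, hcomm, LinearMap.comp_apply]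

/-- **Relations descend with one extra factor**: if `N ι = ι N'`, `N'` vanishes on `ker ι`, and `P(N) = 0`, then
`N' P(N') = 0` (`ι P(N') w = P(N) ι w = 0`, so `P(N') w ∈ ker ι ⊆ ker N'`). [cite: HatcherAT2002, §2.1 Thm. 2.20] -/
theorem aeval_X_mul_eq_zero_of_comp_eq_of_ker_le (ι : W →ₗ[K] V) (N : Module.End K V) (N' : Module.End K W)
    (hcomm : N ∘ₗ ι = ι ∘ₗ N') (hker : LinearMap.ker ι ≤ LinearMap.ker N') {P : K[X]} (hP : aeval N P = 0) :
    aeval N' (X * P) = 0 := by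
  refine LinearMap.ext fun w => ?_
  rw [aeval_mul, aeval_X, Module.End.mul_apply, LinearMap.zero_apply]
  have hw : aeval N' P w ∈ LinearMap.ker ι := by
    rw [LinearMap.mem_ker, apply_aeval_eq_of_comp_eq ι N N' hcomm P w, hP, LinearMap.zero_apply]
  exact LinearMap.mem_ker.1 (hker hw)

/-- **Nilpotency descends**: if `N ι = ι N'`, `N'` vanishes on `ker ι` and `N^k = 0`, then `N'^{k+1} = 0`.
[cite: HatcherAT2002, §2.1 Thm. 2.20] -/
theorem pow_succ_eq_zero_of_comp_eq_of_ker_le (ι : W →ₗ[K] V) (N : Module.End K V) (N' : Module.End K W)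
    (hcomm : N ∘ₗ ι = ι ∘ₗ N') (hker : LinearMap.ker ι ≤ LinearMap.ker N') {k : ℕ} (hk : N ^ k = 0) :
    N' ^ (k + 1) = 0 := by
  have h := aeval_X_mul_eq_zero_of_comp_eq_of_ker_le ι N N' hcomm hker (P := X ^ k) (by rw [aeval_X_pow, hk])
  rwa [← pow_succ', aeval_X_pow] at h

/-- Nilpotency descends (`IsNilpotent` form). [cite: HatcherAT2002, §2.1 Thm. 2.20] -/
theorem isNilpotent_of_comp_eq_of_ker_le (ι : W →ₗ[K] V) (N : Module.End K V) (N' : Module.End K W)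
    (hcomm : N ∘ₗ ι = ι ∘ₗ N') (hker : LinearMap.ker ι ≤ LinearMap.ker N') (hN : IsNilpotent N) :
    IsNilpotent N' := by
  obtain ⟨k, hk⟩ := hN
  exact ⟨k + 1, pow_succ_eq_zero_of_comp_eq_of_ker_le ι N N' hcomm hker hk⟩

/-- Relations are transported by conjugation along a linear equivalence: `P(e f e⁻¹) = 0 ↔ P(f) = 0`.
[cite: HatcherAT2002, §2.1] -/
theorem aeval_conj_eq_zero_iff {V' : Type*} [AddCommGroup V'] [Module K V'] (e : V ≃ₗ[K] V')
    (f : Module.End K V) (P : K[X]) : aeval (e.conj f) P = 0 ↔ aeval f P = 0 := by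
  have h : aeval (e.conj f) P = e.conjAlgEquiv K (aeval f P) := by
    change aeval (e.conjAlgEquiv K f) P = _
    rw [aeval_algEquiv]
    rfl
  rw [h, map_eq_zero_iff _ (e.conjAlgEquiv K).injective]

end LinearMap

namespace Literature.AlgebraicTopology.SingularHomology

/-! ### §2 Homology -/

namespace singularHomology

variable (R : Type v) [CommRing R] (M : Type v) [AddCommGroup M] [Module R M]
  {X : Type u} [TopologicalSpace X]

/-- **Global polynomial relations descend to the invariant piece**: for an open cover `X = A ∪ B`, `h = id` on `B`,
`h(A) ⊆ A` (restriction `h_A`): if `P(h_* − 1) = 0` on `Hₙ(X; M)` then `(h_{A*} − 1)·P(h_{A*} − 1) = 0` on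
`Hₙ(A; M)` — naturality `(h_* − 1) ι_{A*} = ι_{A*} (h_{A*} − 1)` and the vanishing of `h_{A*} − 1` on
`ker ι_{A*} = ∂ Hₙ₊₁(X, A)` (`map_sub_self_eq_zero_of_mem_ker_of_eqOn`).
[cite: HatcherAT2002, §2.1 Thm. 2.13 ff. and Thm. 2.20] [cite: ArnoldGuseinzadeVarchenko2012, Part I §1.1 (held text p0013)] -/
theorem aeval_X_mul_map_sub_id_eq_zero_of_eqOn {A B : Set X} (hAo : IsOpen A) (hBo : IsOpen B) (hAB : A ∪ B = univ)
    (h : C(X, X)) (hB : ∀ x ∈ B, h x = x) (hA : C(↥A, ↥A)) (hhA : ∀ a : ↥A, ((hA a : ↥A) : X) = h a) (n : ℕ)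
    {P : R[X]} (hP : aeval ((map R M h n).hom - LinearMap.id) P = 0) :
    aeval ((map R M hA n).hom - LinearMap.id) (Polynomial.X * P) = 0 := by
  refine LinearMap.aeval_X_mul_eq_zero_of_comp_eq_of_ker_le (map R M (subsetIncl A) n).hom _ _ ?_ ?_ hP
  · refine LinearMap.ext fun a => ?_
    rw [LinearMap.comp_apply, LinearMap.comp_apply, LinearMap.sub_apply, LinearMap.sub_apply, LinearMap.id_apply,
      LinearMap.id_apply, map_sub]
    exact congrArg (· - _) (map_map_subsetIncl R M h hA hhA n a)
  · intro a ha
    rw [LinearMap.mem_ker] at ha ⊢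
    rw [LinearMap.sub_apply, LinearMap.id_apply]
    exact map_sub_self_eq_zero_of_mem_ker_of_eqOn R M hAo hBo hAB h hB hA hhA n a ha

/-- **Unipotent globally ⟹ unipotent locally**: if `h_* − 1` is nilpotent on `Hₙ(X; M)` then `(h_A)_* − 1` is
nilpotent on `Hₙ(A; M)` (exponent one higher). [cite: HatcherAT2002, §2.1 Thm. 2.20]
[cite: ArnoldGuseinzadeVarchenko2012, Part I §1.1 (held text p0013)] -/
theorem isNilpotent_map_sub_id_of_eqOn {A B : Set X} (hAo : IsOpen A) (hBo : IsOpen B) (hAB : A ∪ B = univ)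
    (h : C(X, X)) (hB : ∀ x ∈ B, h x = x) (hA : C(↥A, ↥A)) (hhA : ∀ a : ↥A, ((hA a : ↥A) : X) = h a) (n : ℕ)
    (hnil : IsNilpotent ((map R M h n).hom - LinearMap.id)) :
    IsNilpotent ((map R M hA n).hom - LinearMap.id) := by
  obtain ⟨k, hk⟩ := hnil
  have h1 := aeval_X_mul_map_sub_id_eq_zero_of_eqOn R M hAo hBo hAB h hB hA hhA n (P := Polynomial.X ^ k)
    (by rw [aeval_X_pow, hk])
  rw [← pow_succ', aeval_X_pow] at h1
  exact ⟨k + 1, h1⟩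

variable (F : Type v) [Field F]

/-- **Transfer of relations to a model along a chart bijective on homology**: if `e : A → F₀` is bijective on
`Hₙ( · ; F)` and `e ∘ g ≃ μ ∘ e`, then `Q(g_* − 1) = 0 ↔ Q(μ_* − 1) = 0` (`g_* − 1` and `μ_* − 1` are conjugate by
`e_*`). [cite: HatcherAT2002, §2.1 Thm. 2.10] -/
theorem aeval_map_sub_id_eq_zero_iff_of_homologyConj (n : ℕ) {A F₀ : Type u} [TopologicalSpace A]
    [TopologicalSpace F₀] (e : C(A, F₀)) (hbij : Function.Bijective (map F F e n).hom) (g : C(A, A)) (μ : C(F₀, F₀))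
    (hconj : (e.comp g).Homotopic (μ.comp e)) (Q : F[X]) :
    aeval ((map F F g n).hom - LinearMap.id) Q = 0 ↔ aeval ((map F F μ n).hom - LinearMap.id) Q = 0 := by
  let E : singularHomology F F A n ≃ₗ[F] singularHomology F F F₀ n := LinearEquiv.ofBijective (map F F e n).hom hbij
  have hnat : (map F F e n).hom ∘ₗ (map F F g n).hom = (map F F μ n).hom ∘ₗ (map F F e n).hom := by
    refine LinearMap.ext fun a => ?_
    rw [LinearMap.comp_apply, LinearMap.comp_apply, ← ModuleCat.comp_apply, ← map_comp, ← ModuleCat.comp_apply,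
      ← map_comp, map_eq_of_homotopic F F hconj n]
  have hconjE : E.conj ((map F F g n).hom - LinearMap.id) = (map F F μ n).hom - LinearMap.id := by
    refine LinearMap.ext fun y => ?_
    obtain ⟨a, rfl⟩ := E.surjective y
    rw [LinearEquiv.conj_apply_apply, E.symm_apply_apply, LinearMap.sub_apply, LinearMap.id_apply, map_sub,
      LinearMap.sub_apply, LinearMap.id_apply]
    congr 1
    exact LinearMap.congr_fun hnat a
  rw [← hconjE, LinearMap.aeval_conj_eq_zero_iff]

end singularHomology

/-! ### §3 Cohomology over a field: relations of `h^*` are relations of `h_*` -/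

namespace singularCohomology

variable (F : Type v) [Field F] {X : Type u} [TopologicalSpace X]

/-- Powers of the transpose: `(f^i)ᵀ = (fᵀ)^i`. [cite: HatcherAT2002, §3.1 p. 201] -/
theorem dualMap_pow {V : Type*} [AddCommGroup V] [Module F V] (f : Module.End F V) (i : ℕ) :
    (f ^ i).dualMap = f.dualMap ^ i := by
  induction i with
  | zero => rw [pow_zero, pow_zero]; exact LinearMap.dualMap_id
  | succ i ih => rw [pow_succ, pow_succ', Module.End.mul_eq_comp, Module.End.mul_eq_comp,
      ← LinearMap.dualMap_comp_dualMap, ih]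

/-- `P(fᵀ) = P(f)ᵀ`. [cite: HatcherAT2002, §3.1 p. 201] -/
theorem aeval_dualMap {V : Type*} [AddCommGroup V] [Module F V] (f : Module.End F V) (P : F[X]) :
    aeval f.dualMap P = (aeval f P).dualMap := by
  rw [aeval_eq_sum_range, aeval_eq_sum_range]
  change _ = Module.Dual.transpose (R := F) (∑ i ∈ Finset.range (P.natDegree + 1), P.coeff i • f ^ i)
  rw [map_sum]
  refine Finset.sum_congr rfl fun i _ => ?_
  rw [map_smul]
  change _ = P.coeff i • (f ^ i).dualMap
  rw [dualMap_pow]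

/-- **A relation of `h^*` is a relation of `h_*`** (field coefficients, `Hₙ(X; F)` finite-dimensional): if an
automorphism `T` of `Hⁿ(X; F)` acts as `h^*` and `P(T − 1) = 0`, then `P(h_* − 1) = 0` on `Hₙ(X; F)` — the Kronecker
map conjugates `T − 1` to `(h_* − 1)ᵀ`, and `Qᵀ = 0 ⟹ Q = 0` (duals separate points).
[cite: HatcherAT2002, §3.1 Thm. 3.2 (p. 195) and p. 201] -/
theorem aeval_homologyMap_sub_id_eq_zero_of_aeval_eq_zero (h : C(X, X)) (n : ℕ)
    [Module.Finite F (singularHomology F F X n)] (T : singularCohomology F F X n ≃ₗ[F] singularCohomology F F X n)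
    (hT : ∀ x, T x = (singularCohomology.map F F h n).hom x) {P : F[X]}
    (hP : aeval ((T : singularCohomology F F X n →ₗ[F] singularCohomology F F X n) - LinearMap.id) P = 0) :
    aeval ((singularHomology.map F F h n).hom - LinearMap.id) P = 0 := by
  have hκ := kroneckerPairing_bijective_of_field F X n
  let K : singularCohomology F F X n ≃ₗ[F] Module.Dual F (singularHomology F F X n) :=
    LinearEquiv.ofBijective (kroneckerPairing F F X n) hκ
  have hT' : (T : singularCohomology F F X n →ₗ[F] singularCohomology F F X n) = (singularCohomology.map F F h n).hom :=
    LinearMap.ext fun x => hT x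
  have hconj : K.conj ((singularCohomology.map F F h n).hom - LinearMap.id) =
      ((singularHomology.map F F h n).hom - LinearMap.id).dualMap := by
    refine LinearMap.ext fun y => ?_
    obtain ⟨a, rfl⟩ := K.surjective y
    rw [LinearEquiv.conj_apply_apply, K.symm_apply_apply]
    exact LinearMap.congr_fun (kroneckerPairing_comp_cohomologyMap_sub_id F h n) a
  rw [hT'] at hP
  have h1 : aeval ((singularHomology.map F F h n).hom - LinearMap.id).dualMap P = 0 := by
    rw [← hconj, LinearMap.aeval_conj_eq_zero_iff]; exact hP
  rw [aeval_dualMap] at h1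
  refine LinearMap.ext fun z => ?_
  rw [LinearMap.zero_apply]
  refine (Module.forall_dual_apply_eq_zero_iff F _).1 fun φ => ?_
  have h2 := LinearMap.congr_fun (LinearMap.congr_fun h1 φ) z
  rwa [LinearMap.dualMap_apply, LinearMap.zero_apply, LinearMap.zero_apply] at h2

/-- **End-to-end: a relation of THE cohomological monodromy descends to the model.** For an open cover `X = A ∪ B`,
`h = id` on `B`, `h(A) ⊆ A` (restriction `h_A`), field coefficients with `Hₙ(X; F)` finite-dimensional, a chart
`e : A → F₀` bijective on `Hₙ( · ; F)` with `e ∘ h_A ≃ μ ∘ e`, and an automorphism `T` of `Hⁿ(X; F)` acting as `h^*`: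
**`P(T − 1) = 0 ⟹ (μ_* − 1)·P(μ_* − 1) = 0` on `Hₙ(F₀; F)`**; in particular `T` unipotent ⟹ `μ_*` unipotent.
[cite: HatcherAT2002, §2.1 Thm. 2.10, Thm. 2.20 and §3.1 p. 201] [cite: ArnoldGuseinzadeVarchenko2012, Part I §1.1 and §2.3] -/
theorem aeval_X_mul_modelMap_sub_id_eq_zero_of_eqOn {A B : Set X} (hAo : IsOpen A) (hBo : IsOpen B)
    (hAB : A ∪ B = univ) (h : C(X, X)) (hB : ∀ x ∈ B, h x = x) (hA : C(↥A, ↥A))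
    (hhA : ∀ a : ↥A, ((hA a : ↥A) : X) = h a) (n : ℕ) [Module.Finite F (singularHomology F F X n)]
    {F₀ : Type u} [TopologicalSpace F₀] (e : C(↥A, F₀))
    (hbij : Function.Bijective (singularHomology.map F F e n).hom) (μ : C(F₀, F₀))
    (hconj : (e.comp hA).Homotopic (μ.comp e))
    (T : singularCohomology F F X n ≃ₗ[F] singularCohomology F F X n)
    (hT : ∀ x, T x = (singularCohomology.map F F h n).hom x) {P : F[X]}
    (hP : aeval ((T : singularCohomology F F X n →ₗ[F] singularCohomology F F X n) - LinearMap.id) P = 0) :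
    aeval ((singularHomology.map F F μ n).hom - LinearMap.id) (Polynomial.X * P) = 0 := by
  have h1 := aeval_homologyMap_sub_id_eq_zero_of_aeval_eq_zero F h n T hT hP
  have h2 := singularHomology.aeval_X_mul_map_sub_id_eq_zero_of_eqOn F F hAo hBo hAB h hB hA hhA n h1
  exact (singularHomology.aeval_map_sub_id_eq_zero_iff_of_homologyConj F n e hbij hA μ hconj _).1 h2

end singularCohomology

end Literature.AlgebraicTopology.SingularHomology

end
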